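/-
Origin: expansion seat `planner-pub-hodgecm-pv15-g5-0`, handover #1 v2 2026-08-18T12:02:20Z (restated for p-g8; first posted 10:54:02Z; rewrite Pv14g5.WeilThetaModelHeisenbergLattice -> Automorphic) (`HOME/pub-hodgecm-pv15-g5/lean/Pv15g5/KernelModelHeisenberg.lean`, md5 5ccad6e3, 838 lines);
landed by the gen-8 packager in gate run 29 as `HodgeCM/Automorphic/KernelModelHeisenberg.lean` (import ^import Pv14g5\.→import HodgeCM.Automorphic. ×1).
-/
/-
Origin: HOME/pub-hodgecm-pv15-g5/lean/Pv15g5/KernelModelHeisenberg.lean — session planner-pub-hodgecm-pv15-g5-0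
(unit pub-hodgecm-pv15-g5, DAG-NODE PROVER #15 gen 5; lineage N23a → N23c, PerL v5 Prop 3.6 Step 2, ll. 386–438).
Intended final place (packager's call): `HodgeCM/Automorphic/KernelModelHeisenberg.lean`.
NEW, ADDITIVE LEAF.  PACKAGER: rewrite `import Pv14g5.WeilThetaModelHeisenbergLattice` to
`import HodgeCM.Automorphic.WeilThetaModelHeisenbergLattice` (pv14-g5 HANDOVER #7 — this file lands AFTER pv14-g5 #4/#5/#7);
the other three imports are tree modules (pv15-g2 runs 25/26, pv09-g4 run 23).
KIND: KERNEL — complete proofs, no new axioms, nothing cited, nothing posited, NO `Prop`-valued hypothesis anywhere.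
-/
import Summits.HodgeConjecture.HodgeCM.Automorphic.WeilThetaModelHeisenbergLattice
import Summits.HodgeConjecture.HodgeCM.Automorphic.KernelCompactTorusModel
import Summits.HodgeConjecture.HodgeCM.Automorphic.LatticePartitionOfUnity
import Summits.HodgeConjecture.HodgeCM.PerL34.DiscreteFundamentalDomain_2

/-!
# The theta-KERNEL MODEL of N23a/N23c on a NON-ABELIAN acting group: the Heisenberg theta kernel

pv15-g2's kernel model of PerL v5 Prop. 3.6 (`KernelModel.core` → `KernelTorusCarrier` → `KernelTorusCarrier.CompactInput`
⇒ `analyticK_of_compactInput`, runs 24–26) proves AX5b, AX12 (i)(ii), the unfolding identity (U), `fourier` and AX8 =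
`AnalyticK` for ANY theta kernel with the three structural laws over ANY cocompact Haar model of `[U(W)]` and ANY
compact-quotient torus input.  Its constructed inhabitants so far (pv15-g4 `KernelModelSchrodinger`, run 28 queue) have an
ABELIAN acting group `U(W) ↦ U(1)`, the torus `T = U(W)` ITSELF, finite `T(L₀)`, ONE character and trivial `U(W)(𝔸_f)` — the
degenerate corner of the `CompactInput` interface.  This file feeds the SAME machinery pv14-g5's genuinely non-abelian
Schrödinger–Heisenberg–lattice theta kernel (`WeilThetaModelHeisenberg`, `…Lattice`, RUN 28/29 queue) with the rôles of the
dual pair SWAPPED so that the HEISENBERG GROUP ACTS: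

* §1 `centerModel : WeilThetaModel U(1) Γz (Heis V) (arith V L m)` — `G_U(𝔸) ↦` the centre `U(1)` (rational points a finite
  `Γz ⊆ μ_m`), `U(W)(𝔸) ↦ Heis V = V × V × U(1)` acting on `𝓢(V, ℂ)` by the weight-`m` Schrödinger representation,
  `U(W)(L₀) ↦ arith = {(a, b, u) : a ∈ L, m b ∈ L*, uᵐ = 1}` (a compact NILMANIFOLD quotient, pv14-g5 #7), splitting
  `s(z, h) = c(z) h` (`centralSplitting`, a homomorphism because the centre is central), `SK := 𝓢(V, ℂ)`; every field a theorem
  of pv14-g5 #5.  Its kernel is pv14-g5's kernel with the two variables exchanged (`centerModel_θ_swap`):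
  `θ_Φ(zΓz, h·arith) = Θ_Φ(h⁻¹ c(z⁻¹))`.
* §2 the kernel core carrier `core := KernelModel.core QZ QH 𝓢 ω Θ` over the quotient models `QZ = U(1) ⧸ Γz`, `QH = Heis V ⧸
  arith` (prl1-g4 `QuotientModel.ofLattice`: Haar measure, unimodularity, fundamental domain — CONSTRUCTED), its three STRUCTURAL
  LAWS (`structural`) and AX1b(a) (`hatτ_complete`).
* §3 the torus side, NON-DEGENERATE in every slot of the interface: `T(𝔸) := V × U(1)` (the maximal abelian subgroup
  `{(a, 0, u)}`, NOT compact, `jT = Heis.ofSchrodinger` a proper inclusion), `T(L₀) := Λ = L × μ_m` (INFINITE discrete,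
  cocompact), a genuine `Λ`-partition of unity `β ∈ C_c(T)` (pv15-g2 `LatticePU.exists_partitionOfUnity`), compact torus
  `T(L₀ ⊗ ℝ) := U(1)` = the centre with weight `w(u) = u^{-m}`, allowed characters `X :=` ALL characters `ξ` of
  `[T] = (V ⧸ L) × (U(1) ⧸ μ_m)` with `ξ|_{centre} = w` (infinitely many: `L* × {w}`), finite-adelic stand-in
  `U(W)(𝔸_f) ↦ {(0, b, 1)} ≅ V` (`modHom`, commuting with the centre) with `arith · T · {(0,b,1)} = Heis V` (dense: it is
  everything).  AX5b (`AX5b`), AX12(i) (`AX12_transl_cont`) and (U) = AX12(ii) (`AX12_unfold`) hold BY NAME; the kernel along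
  the torus is COMPUTED (`centerModel_θ_torus`, `θ_pt`: `θ_Φ(zΓz, π(jT(a,u)⁻¹)) = uᵐ z⁻ᵐ Σ_{v ∈ L} Φ(v − a)`), hence the toric period
  (`ϑc_mk`): `ϑ_{T,ξ}(Φ)(zΓz) = z⁻ᵐ ∫_T β(t) ξ(a, 1) Σ_{v ∈ L} Φ(v − a) dν(t)` — a `w`-eigenfunction of the centre (`w(z) = z⁻ᵐ`) —, and
  for the basic character `χ₀(a, u) = u⁻ᵐ` it is NON-ZERO on a bump (`ϑc_ne_zero`; positivity of a `β`-weighted integral) —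
  indeed for EVERY allowed `ξ` (`ϑc_ne_zero_of_mem`: `ξ(·, 1)` is `L`-periodic and continuous, so a small bump sees an almost
  constant phase: `|ϑ_{T,ξ}(φ)(1)| ≥ ½ ∫ β Σ_L φ > 0`).
* §4 `compactInput : torusCarrier.CompactInput` CONSTRUCTED field by field (`exists_fd` = pv09-g4, `β_sum`, `Ew_eq := rfl`,
  `emb := Subtype.val`, `emb_spec := rfl`, `emb_surj` = the definition of `X`, `comm`, `dense`), hence
  **`analyticK : torusCarrier.AnalyticK`** (AX8) and **`analyticU`** (run 24's analytic package incl. (U)) with NO HYPOTHESIS,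
  and a smoke instance `V = ℝⁿ`, `L = ℤⁿ`, `Γz = 1` found by Lean.

HONEST SCOPE.  An archimedean SHADOW (one real place; `X_k ↦ L`, `S(X_𝔸) ↦ 𝓢(V, ℂ)`, `Mp ↦ Heis V`), NOT PerL's adelic
`U(2,1)`/`𝒮^κ` theta kernel: DIVERGENCE.md and GAPS carverg2-X1 (the genuine adelic MODEL, prl1/pv09/pv06 lanes) stand.  Content
= a non-vacuity / composability certificate for the kernel-model torus package in the regime it was built for and never
exercised in: non-abelian `U(W)(𝔸)`, non-compact `T(𝔸) ⊊ U(W)(𝔸)`, infinite `T(L₀)`, non-constant `β`, infinitely many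
allowed characters, non-trivial `U(W)(𝔸_f)`-factor in the density statement — all binder types simultaneously inhabited,
`analyticK_of_compactInput` and `AnalyticK.toAnalyticU` composing end-to-end in the kernel, toric periods not zero.

PUBLISHED inputs cited as hypotheses: none.  No placeholders; axioms ⊆ {propext, Classical.choice, Quot.sound}.
Borel structures: Mathlib fixes no σ-algebra on `Circle` nor on `Multiplicative V`; this file uses the Borel σ-algebras
(`borelCircle`, `borelT`: reducible local instances, the convention of `SchrodingerKernel`/`ModelCarrier` §ModelSanity).
-/

set_option autoImplicit false

noncomputable section

open MeasureTheory Topology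
open HodgeCM.PerL34 HodgeCM.PerL34.Annihilation

open scoped RealInnerProductSpace FourierTransform SchwartzMap CompactlySupported

attribute [-instance] Quotient.instMeasurableSpace

namespace HodgeCM
namespace SchwartzWeil
namespace HeisenbergKernel

/-- The Borel σ-algebra on `U(1)` (Mathlib registers none). -/
@[reducible] def borelCircle : MeasurableSpace Circle := borel Circle

attribute [local instance] borelCircle

/-- (Ported verbatim from the HodgeCMPerL package; no docstring in the source.) -/
local instance borelSpace_circle : BorelSpace Circle := ⟨rfl⟩

section BorelT

variable (V : Type) [NormedAddCommGroup V]

/-- The Borel σ-algebra on the torus `T(𝔸) := V × U(1)`, realised as `Multiplicative V × Circle` (Mathlib registers no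
measurable structure on `Multiplicative V`, so no product instance competes). -/
@[reducible] def borelT : MeasurableSpace (Multiplicative V × Circle) := borel _

attribute [local instance] borelT

/-- (Ported verbatim from the HodgeCMPerL package; no docstring in the source.) -/
local instance borelSpace_T : BorelSpace (Multiplicative V × Circle) := ⟨rfl⟩

end BorelT

attribute [local instance] borelT borelSpace_T

/-! ## 1. The centre–Heisenberg Weil theta model: the Heisenberg group ACTS, the centre is the `G_U`-variable -/

section Splitting

variable (V : Type) [NormedAddCommGroup V] [InnerProductSpace ℝ V]

/-- The dual-pair splitting with the rôles of pv14-g5's `Heis.splitting` exchanged: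
`s : U(1) × Heis V →* Heis V`, `(z, h) ↦ c(z) · h` — a homomorphism because the centre is central. -/
def centralSplitting : Circle × Heis V →* Heis V :=
  MonoidHom.mk' (fun p => Heis.center p.1 * p.2) fun p q => by
    simp only [Prod.fst_mul, Prod.snd_mul, map_mul, mul_assoc]
    congr 1
    rw [← mul_assoc, Heis.center_mul_comm q.1 p.2, mul_assoc]

/-- (Ported verbatim from the HodgeCMPerL package; no docstring in the source.) -/
@[simp] theorem centralSplitting_apply (p : Circle × Heis V) : centralSplitting V p = Heis.center p.1 * p.2 := rfl

/-- (Ported verbatim from the HodgeCMPerL package; no docstring in the source.) -/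
theorem continuous_centralSplitting : Continuous (centralSplitting V) :=
  (Heis.continuous_center.comp continuous_fst).mul continuous_snd

/-- The modulation subgroup `b ↦ (0, b, 1)` of `Heis V` — the stand-in for the finite-adelic factor `U(W)(𝔸_f)` of the
density statement: it commutes with the centre and, together with the Schrödinger torus `{(a, 0, u)}`, exhausts `Heis V`. -/
def modHom : Multiplicative V →* Heis V where
  toFun b := ⟨0, Multiplicative.toAdd b, 1⟩
  map_one' := rfl
  map_mul' b b' := by
    ext
    · simp
    · simp
    · simp

/-- (Ported verbatim from the HodgeCMPerL package; no docstring in the source.) -/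
@[simp] theorem modHom_a (b : Multiplicative V) : (modHom V b).a = 0 := rfl
/-- (Ported verbatim from the HodgeCMPerL package; no docstring in the source.) -/
@[simp] theorem modHom_b (b : Multiplicative V) : (modHom V b).b = Multiplicative.toAdd b := rfl
/-- (Ported verbatim from the HodgeCMPerL package; no docstring in the source.) -/
@[simp] theorem modHom_u (b : Multiplicative V) : (modHom V b).u = 1 := rfl

/-- (Ported verbatim from the HodgeCMPerL package; no docstring in the source.) -/
theorem ofSchrodinger_injective :
    Function.Injective (Heis.ofSchrodinger : Multiplicative V × Circle → Heis V) :=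
  fun _ _ h => Prod.ext (Multiplicative.toAdd.injective (congrArg Heis.a h)) (congrArg Heis.u h)

/-- The modulations commute with the centre `(0, 0, u) = jT(1, u)`. -/
theorem modHom_mul_ofSchrodinger_one (b : Multiplicative V) (u : Circle) :
    modHom V b * Heis.ofSchrodinger (1, u) = Heis.ofSchrodinger (1, u) * modHom V b := by
  ext
  · simp
  · simp
  · simp

/-- Every `h = (a, b, u) ∈ Heis V` is a Schrödinger-torus element times a modulation:
`(a, b, u) = (a, 0, u·𝐞(⟪a, b⟫)) · (0, b, 1)`. -/
theorem eq_ofSchrodinger_mul_modHom (h : Heis V) :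
    h = Heis.ofSchrodinger (Multiplicative.ofAdd h.a, h.u * 𝐞 ⟪h.a, h.b⟫) * modHom V (Multiplicative.ofAdd h.b) := by
  ext
  · simp
  · simp
  · simp only [Heis.mul_u, Heis.ofSchrodinger_u, Heis.ofSchrodinger_a, modHom_u, modHom_b, toAdd_ofAdd,
      mul_one, AddChar.map_neg_eq_inv, mul_inv_cancel_right]

end Splitting

section Model

variable (V : Type) [NormedAddCommGroup V] [InnerProductSpace ℝ V] [FiniteDimensional ℝ V] [MeasurableSpace V]
  [BorelSpace V] (L : Submodule ℤ V) [DiscreteTopology L] (m : ℤ) (Γz : Subgroup Circle)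
  (hΓz : ∀ z ∈ Γz, z ^ m = 1)

/-- **The centre–Heisenberg Weil theta model.**  prl1-g4's `WeilThetaModel U(1) Γz (Heis V) (arith V L m)` — `G_U ↦`
the centre `U(1)` with rational points `Γz ⊆ μ_m`, `U(W) ↦ Heis V` ACTING by the weight-`m` Schrödinger representation
on `𝓢(V, ℂ)`, `U(W)(L₀) ↦ arith V L m` — with every field a theorem of pv14-g5 #5: the datum is `datumH`, the splitting is
`centralSplitting`, `SK := univ`. -/
def centerModel : HodgeCM.WeilThetaModel Circle Γz (Heis V) (arith V L m) where
  W := datumH V L m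
  act_one := repCLM_one_apply V m
  theta_act := thetaH_repCLM V L m
  actionContinuous := actionContinuousH V L m
  thetaContinuousInvariant := thetaContinuousInvariantH V L m
  dist_cont := continuous_thetaH_left V L m 1
  s := centralSplitting V
  s_cont := continuous_centralSplitting V
  s_rat := fun z hz _ hh => (arith V L m).mul_mem (center_mem_arith V L m (hΓz z hz)) hh
  SK := Set.univ
  SK_stable := fun _ _ _ => Set.mem_univ _

/-- (Ported verbatim from the HodgeCMPerL package; no docstring in the source.) -/
@[simp] theorem centerModel_W : (centerModel V L m Γz hΓz).W = datumH V L m := rfl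

/-- (Ported verbatim from the HodgeCMPerL package; no docstring in the source.) -/
@[simp] theorem centerModel_SK : (centerModel V L m Γz hΓz).SK = Set.univ := rfl

/-- (Ported verbatim from the HodgeCMPerL package; no docstring in the source.) -/
@[simp] theorem centerModel_s_apply (p : Circle × Heis V) :
    (centerModel V L m Γz hΓz).s p = Heis.center p.1 * p.2 := rfl

/-- `ω(h)Φ = ρ_m(h)Φ`: the Weil action of the model IS the Schrödinger representation of `Heis V`. -/
theorem centerModel_omg (h : Heis V) (Φ : (centerModel V L m Γz hΓz).SK) :
    ((centerModel V L m Γz hΓz).omg h Φ).1 = repCLM V m h Φ.1 := by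
  have h1 : (centerModel V L m Γz hΓz).s (1, h) = h :=
    (congrArg (· * h) (map_one (Heis.center (V := V)))).trans (one_mul h)
  rw [WeilThetaModel.coe_omg, h1]
  exact datumH_act V L m h Φ.1

/-- The kernel on representatives: `θ_Φ(zΓz, h·arith) = Θ_Φ(s((z, h)⁻¹)) = Θ_Φ(c(z⁻¹) h⁻¹)`. -/
theorem centerModel_θ_mk (Φ : 𝓢(V, ℂ)) (z : Circle) (h : Heis V) :
    (centerModel V L m Γz hΓz).θ ⟨Φ, Set.mem_univ Φ⟩ (QuotientGroup.mk z, QuotientGroup.mk h) =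
      thetaH V L m Φ (Heis.center z⁻¹ * h⁻¹) := by
  rw [WeilThetaModel.θ_mk]
  rfl

/-- … `= Θ_Φ(h⁻¹ c(z⁻¹))` (the centre is central). -/
theorem centerModel_θ_mk' (Φ : 𝓢(V, ℂ)) (z : Circle) (h : Heis V) :
    (centerModel V L m Γz hΓz).θ ⟨Φ, Set.mem_univ Φ⟩ (QuotientGroup.mk z, QuotientGroup.mk h) =
      thetaH V L m Φ (h⁻¹ * Heis.center z⁻¹) := by
  rw [centerModel_θ_mk, Heis.center_mul_comm]

/-- **It is pv14-g5's Heisenberg theta kernel with the two variables exchanged.** -/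
theorem centerModel_θ_swap (Φ : 𝓢(V, ℂ)) (z : Circle) (h : Heis V) :
    (centerModel V L m Γz hΓz).θ ⟨Φ, Set.mem_univ Φ⟩ (QuotientGroup.mk z, QuotientGroup.mk h) =
      (heisenbergModel V L m Γz hΓz).θ ⟨Φ, Set.mem_univ Φ⟩ (QuotientGroup.mk h, QuotientGroup.mk z) := by
  rw [centerModel_θ_mk', heisenbergModel_θ_mk]

/-- Explicitly, for `h = (a, b, u)`: `θ_Φ(zΓz, h·arith) = u^{-m} z^{-m} 𝐞(-⟪a, b⟫)^m Σ_{v ∈ L} 𝐞(-m⟪b, v⟫) Φ(v + a)`. -/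
theorem centerModel_θ_mk_eq (Φ : 𝓢(V, ℂ)) (z : Circle) (h : Heis V) :
    (centerModel V L m Γz hΓz).θ ⟨Φ, Set.mem_univ Φ⟩ (QuotientGroup.mk z, QuotientGroup.mk h) =
      ((h.u : ℂ) ^ m)⁻¹ * ((z : ℂ) ^ m)⁻¹ * (((𝐞 (-⟪h.a, h.b⟫) : Circle) : ℂ) ^ m) *
        ∑' v : L, (𝐞 (-⟪(m : ℝ) • h.b, (v : V)⟫) : ℂ) * Φ ((v : V) + h.a) := by
  rw [centerModel_θ_swap, heisenbergModel_θ_mk_eq]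

/-- **The kernel along the Schrödinger torus, computed**: for `t = (a, u)`,
`θ_Φ(zΓz, (jT t)⁻¹·arith) = Θ_Φ((a, 0, u) c(z⁻¹)) = uᵐ z⁻ᵐ Σ_{v ∈ L} Φ(v − a)`. -/
theorem centerModel_θ_torus (Φ : 𝓢(V, ℂ)) (z : Circle) (t : Multiplicative V × Circle) :
    (centerModel V L m Γz hΓz).θ ⟨Φ, Set.mem_univ Φ⟩
        (QuotientGroup.mk z, QuotientGroup.mk (Heis.ofSchrodinger t)⁻¹) =
      (t.2 : ℂ) ^ m * ((z : ℂ) ^ m)⁻¹ * ∑' v : L, Φ ((v : V) - Multiplicative.toAdd t.1) := by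
  rw [centerModel_θ_mk, inv_inv, thetaH_eq]
  simp only [Heis.mul_a, Heis.mul_b, Heis.mul_u, Heis.ofSchrodinger_a, Heis.ofSchrodinger_b, Heis.ofSchrodinger_u,
    Heis.center_a, Heis.center_b, Heis.center_u, zero_add, smul_zero, inner_zero_left, neg_zero,
    AddChar.map_zero_eq_one, Circle.coe_one, one_mul, mul_one, Circle.coe_mul, Circle.coe_inv, mul_zpow, inv_zpow]
  ring

/-- Non-degeneracy: `θ_Φ(1, 1) = Θ_Φ(1) = 1` for pv14-g5's bump. -/
theorem centerModel_θ_ne_zero :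
    ∃ Φ, (centerModel V L m Γz hΓz).θ Φ (QuotientGroup.mk 1, QuotientGroup.mk 1) ≠ 0 := by
  obtain ⟨Φ, hΦ⟩ := heisenbergModel_θ_ne_zero V L m Γz hΓz
  exact ⟨⟨Φ.1, Set.mem_univ _⟩, by rwa [centerModel_θ_swap]⟩

end Model

/-! ## 2. The quotient models and the kernel core carrier -/

section Core

variable (V : Type) [NormedAddCommGroup V] [InnerProductSpace ℝ V] [FiniteDimensional ℝ V] [MeasurableSpace V]
  [BorelSpace V] (L : Submodule ℤ V) [DiscreteTopology L] [IsZLattice ℝ L] (m : ℤ) [NeZero m]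
  (Γz : Subgroup Circle) [Finite Γz] (hΓz : ∀ z ∈ Γz, z ^ m = 1)

/-- The quotient model of `[G_U] = U(1) ⧸ Γz` (pv14-g5 `circleLatticeModel`, prl1-g4 `QuotientModel.ofLattice`). -/
abbrev QZ : QuotientModel := (circleLatticeModel Γz).toQuotientModel

/-- The quotient model of `[U(W)] = Heis V ⧸ arith V L m`, a compact Heisenberg NILMANIFOLD (pv14-g5 #7
`heisenbergLatticeModel`: `arith` discrete and cocompact for a full lattice `L` and `m ≠ 0`). -/
abbrev QH : QuotientModel := (heisenbergLatticeModel V L m).toQuotientModel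

omit [MeasurableSpace V] [BorelSpace V] in
/-- (Ported verbatim from the HodgeCMPerL package; no docstring in the source.) -/
theorem QH_G : (QH V L m).G = Heis V := rfl
omit [MeasurableSpace V] [BorelSpace V] in
/-- (Ported verbatim from the HodgeCMPerL package; no docstring in the source.) -/
theorem QH_Γ : (QH V L m).Γ = arith V L m := rfl
/-- (Ported verbatim from the HodgeCMPerL package; no docstring in the source.) -/
theorem QZ_G : (QZ Γz).G = Circle := rfl
/-- (Ported verbatim from the HodgeCMPerL package; no docstring in the source.) -/
theorem QZ_Γ : (QZ Γz).Γ = Γz := rfl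

omit [MeasurableSpace V] [BorelSpace V] in
/-- `[U(W)] = Heis V ⧸ arith` is a cocompact Haar model (a theorem of every quotient model). -/
theorem isCocompactHaarModel_QH : RegularRep.IsCocompactHaarModel (QH V L m).Γ (QH V L m).ν (QH V L m).μ :=
  (QH V L m).isCocompactHaarModel

/-- The centre–Heisenberg model read over the quotient models `QZ`, `QH` (same term). -/
abbrev W : WeilThetaModel (QZ Γz).G (QZ Γz).Γ (QH V L m).G (QH V L m).Γ := centerModel V L m Γz hΓz

/-- **The kernel core carrier** of the model: `ω = ρ_m`, `Θ`, `inclCG = periodCLM`, `τ̂ =` the isotypic components of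
`L²(U(1) ⧸ Γz)` (pv15-g2 `KernelModel.core`). -/
abbrev core :=
  KernelModel.core (QZ Γz) (QH V L m) (W V L m Γz hΓz).SK (W V L m Γz hΓz).omg (W V L m Γz hΓz).θ

/-- **The three structural laws hold**: `ω(1) = id`, `Θ` continuous, `Θ_{ω(h)Φ}(ξ, q) = Θ_Φ(ξ, h⁻¹ q)` for `h ∈ Heis V`. -/
theorem structural :
    (∀ Φ, (core V L m Γz hΓz).omg 1 Φ = Φ) ∧ Continuous (core V L m Γz hΓz).θ ∧
      ∀ (h : (QH V L m).G) Φ ξ (q : (QH V L m).G ⧸ (QH V L m).Γ),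
        (core V L m Γz hΓz).θ ((core V L m Γz hΓz).omg h Φ) (ξ, q) = (core V L m Γz hΓz).θ Φ (ξ, h⁻¹ • q) :=
  (W V L m Γz hΓz).structural_laws

/-- **AX1b(a) for the model**: the isotypic components of `L²(U(1) ⧸ Γz)` have dense span (prl1-g3/pv15-g2). -/
theorem hatτ_complete : (⨆ j, (core V L m Γz hΓz).hatτ j).topologicalClosure = ⊤ :=
  KernelModel.core_hatτ_complete (QZ Γz) (QH V L m) _ _ _

/-- `Θ_{ω(h)Φ}` is the `h`-translate of the family `Θ_Φ`, `h ∈ Heis V` (pv15-g2 `KernelCoreCarrier.θ_omg_eq`). -/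
theorem θ_omg_eq (h : (QH V L m).G) (Φ : (W V L m Γz hΓz).SK) :
    (core V L m Γz hΓz).θ ((core V L m Γz hΓz).omg h Φ) = KernelOp.translFamily ((core V L m Γz hΓz).θ Φ) h :=
  (core V L m Γz hΓz).θ_omg_eq (W V L m Γz hΓz).θ_omg h Φ

end Core

/-! ## 3. The torus side: `T(𝔸) = V × U(1)`, `T(L₀) = L × μ_m`, all characters with central weight `u^{-m}` -/

section Weight

variable (m : ℤ)

/-- The weight `w : u ↦ u^{-m}` as a `ℂ`-valued character of the centre `U(1)`. -/
def weightC : Circle →* ℂ := Circle.coeHom.comp (zpowGroupHom (-m))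

/-- (Ported verbatim from the HodgeCMPerL package; no docstring in the source.) -/
@[simp] theorem weightC_apply (u : Circle) : weightC m u = ((u ^ (-m) : Circle) : ℂ) := rfl

/-- (Ported verbatim from the HodgeCMPerL package; no docstring in the source.) -/
theorem continuous_weightC : Continuous (weightC m) :=
  continuous_subtype_val.comp (continuous_zpow (-m))

/-- (Ported verbatim from the HodgeCMPerL package; no docstring in the source.) -/
theorem norm_weightC (u : Circle) : ‖weightC m u‖ = 1 := Circle.norm_coe _

end Weight

/-- The Haar probability measure of `U(1)`. -/
def haarCircle : Measure Circle := Measure.haarMeasure ⊤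

/-- (Ported verbatim from the HodgeCMPerL package; no docstring in the source.) -/
instance isHaarMeasure_haarCircle : (haarCircle).IsHaarMeasure := by
  unfold haarCircle; infer_instance

/-- (Ported verbatim from the HodgeCMPerL package; no docstring in the source.) -/
instance isProbabilityMeasure_haarCircle : IsProbabilityMeasure haarCircle := by
  refine ⟨?_⟩
  have h := Measure.haarMeasure_self (G := Circle) (K₀ := ⊤)
  rwa [TopologicalSpace.PositiveCompacts.coe_top] at h

section CentralWeight

variable (V : Type) [NormedAddCommGroup V] (m : ℤ)

/-- The basic central character `(a, u) ↦ u^{-m}` of `T(𝔸) = V × U(1)`, `U(1)`-valued. -/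
def χ₀Hom : Multiplicative V × Circle →* Circle := (zpowGroupHom (-m)).comp (MonoidHom.snd (Multiplicative V) Circle)

/-- (Ported verbatim from the HodgeCMPerL package; no docstring in the source.) -/
@[simp] theorem χ₀Hom_apply (t : Multiplicative V × Circle) : χ₀Hom V m t = t.2 ^ (-m) := rfl

end CentralWeight

section TorusGroup

variable (V : Type) [NormedAddCommGroup V] [InnerProductSpace ℝ V] (L : Submodule ℤ V) (m : ℤ)

/-- The inclusion `jT : T(𝔸) = V × U(1) ↪ U(W)(𝔸) = Heis V`, `(a, u) ↦ (a, 0, u)` (pv14-g5 `Heis.ofSchrodinger`), as a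
continuous monoid homomorphism. -/
def jT : ContinuousMonoidHom (Multiplicative V × Circle) (Heis V) where
  toMonoidHom := Heis.ofSchrodinger
  continuous_toFun := Heis.continuous_ofSchrodinger

/-- (Ported verbatim from the HodgeCMPerL package; no docstring in the source.) -/
@[simp] theorem jT_apply (t : Multiplicative V × Circle) : jT V t = Heis.ofSchrodinger t := rfl

/-- **`T(L₀) := Λ = jT⁻¹(arith) = L × μ_m`** — an infinite discrete cocompact subgroup of `T(𝔸)`. -/
def ΛT : Subgroup (Multiplicative V × Circle) := (arith V L m).comap Heis.ofSchrodinger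

/-- (Ported verbatim from the HodgeCMPerL package; no docstring in the source.) -/
theorem mem_ΛT {t : Multiplicative V × Circle} : t ∈ ΛT V L m ↔ Multiplicative.toAdd t.1 ∈ L ∧ t.2 ^ m = 1 := by
  rw [ΛT, Subgroup.mem_comap, ofSchrodinger_mem_arith, mem_rat]

/-- (Ported verbatim from the HodgeCMPerL package; no docstring in the source.) -/
instance measurableSpace_quot_ΛT : MeasurableSpace ((Multiplicative V × Circle) ⧸ ΛT V L m) := borel _
/-- (Ported verbatim from the HodgeCMPerL package; no docstring in the source.) -/
instance borelSpace_quot_ΛT : BorelSpace ((Multiplicative V × Circle) ⧸ ΛT V L m) := ⟨rfl⟩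

/-- **The allowed characters**: ALL unitary characters `ξ` of `[T] = T(𝔸) ⧸ T(L₀)` whose pull-back to the centre is the
weight, `ξ(1, u) = u^{-m}` (PerL ll. 425–427 "`χ_∞ = w`"; here: `L* × {w}`, infinitely many). -/
def Xw : Set (PontryaginDual ((Multiplicative V × Circle) ⧸ ΛT V L m)) :=
  {ξ | (dualChar ξ).comp ((QuotientGroup.mk' (ΛT V L m)).comp (MonoidHom.inr (Multiplicative V) Circle)) = weightC m}


-- port_pkg: scope closed for this part
end TorusGroup
end HeisenbergKernel
end SchwartzWeil
end HodgeCM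
end
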